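import Literature.MathematicalPhysics.QuantumFieldTheory.Balaban1983to89.Node00.OpsYBondMapOfRecord
import Literature.MathematicalPhysics.QuantumFieldTheory.Balaban1983to89.Node00.MemberYCornered
import Literature.MathematicalPhysics.QuantumFieldTheory.Balaban1983to89.B9CoReadingCoordsL2S

/-!
# `Balaban1983to89.Node00.OpsYSiteIndexOfRecord` — THE SITE-INDEX MAP OF RECORD `z ↦ sIK (bIOfRecord) z` (the block map of the N06 certificate's
# SITE-SECTOR pins `blkSK (sIK bI)` at def-Y's bond map of record): WHAT HOLDS AT EVERY MEMBER (carrier-faithful on carrier blocks, 1-faithful,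
# level-faithful), AND THE LOCATED NEGATIVE — the exact section law `∀ z, β (sIK bI z) = Δ(z)` holds at a member IFF its carrier-block map `β` is
# onto `𝔅`, hence FAILS at the cornered members of print's family for EVERY index map `bI` (NODE 00, owner file of the `OpsY` instance; count-neutral)

T. Bałaban, *Propagators and renormalization transformations for lattice gauge theories. II*, Commun. Math. Phys. **96** (1984) 223–250
[`Balaban1984PropagatorsII`, "[4]"]: (2.1)–(2.4) p. 224 (the sequence of domains `Ω_j`, blocks of side `L^j`; *"Λ_j also denotes the set of bonds with
at least one end-point in Λ_j"*), (2.45)–(2.46) p. 231 (*"𝔅 = ⋃_j Λ_j"*, the admissible bonds `y ∈ 𝔅`, the blocks `Δ(y)`, the distance `d(y, y′)`), p. 248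
(*"sites replaced by bonds"*).  T. Bałaban, *Propagators for lattice gauge theories in a background field*, Commun. Math. Phys. **99** (1985) 389–434
[`Balaban1985BackgroundPropagators`, "[B9]"]: (3.41) p. 397 (the weighted norms `|A|_(α) = sup_j sup_{b ∈ Ω_j∖Ω_{j+1}} (L^jη)^{−α}|A(b)|` over the
level structure of `{Ω_j}`), (3.42) p. 397 (*«for x ∈ Δ(y), y ∈ Λ_j, supp λ ⊂ Δ(y′)»* — the local estimates are stated BLOCK BY BLOCK over `𝔅`) and (3.87) p. 409,
p. 399 l. 2–4 (*«Let us stress that the constants in the formulations of both theorems do not depend on the sequence {Ω_j}, j = 0, 1, …, k, if the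
conditions (2.1), (2.2) are satisfied»* — the uniformity this lineage reads as «the family (torus, k, {Ω_j}, M) at fixed d, L»; the phrase is ours, not print's).
(v1.1, 2026-08-30: doc-only — the two [B9] locators made precise per ref-F g40 READ-904 NIT-1; declarations byte-identical to v1.0 ✓p764143.)

statement-level skeleton of published theorems with citation tags; proofs where landed; nothing here is a claim about the
Yang–Mills mass gap

THE POINT (dag-n06-c g22 LANDED-6, bus I.32461, question to NODE 00: *«is `∀ z, β (sIK (bIYOfRecord …) z) = blkOf z` already a lemma of yours? name it
and the knit is closed-form»*).  The generic (3.42)-currency bridges `B9Local342OfEBlockInv.hasMajorant_GcoS_of_eBlockInv …` and their pinned forms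
`B9Local342AtPins.local342_of_eBlockInv_pins ∕ local342_opsWalkY_of_eBlockInv` (rows 18) display the EXACT SECTION LAW
`hβs : ∀ z : SiteY i, β (sIK i bI z) = blkOf i.D.toDomains z` of the site-index map `sIK i bI z := bI ⟨z, e₀⟩` (`B9CoReadingCoordsS.sIK`).  THE ANSWER,
kernel-checked here: NO such lemma exists, and none can —
* since `z ↦ Δ(z) = blkOf z` is ONTO the block set (`B6Geom246MultiLevelBox.exists_blkOf_eq`), `hβs` at a member forces its carrier-block map `β` to be
  SURJECTIVE onto `𝔅` (★ `surjective_beta_of_sIK_section`, any `bI`); conversely at a corner-free member (`β` onto) def-Y's map of record satisfies it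
  (`sIK_bIOfRecord_section_of_surjective`, by carrier-faithfulness `bIOfRecord_hβI`) — ★ `sIK_bIOfRecord_section_iff`;
* print's family contains CORNERED members — inner-corner blocks of `𝔅` carrying no index bond — at every odd `L ≥ 5`, `k ≥ 3`, with `M` beyond every
  threshold (NODE 00's landed `Node00.MemberYCornered.memberY_exists_not_surjective_beta ∕ not_forall_memberY_beta_section`); so ★★
  `not_forall_memberY_sIK_section`: for EVERY assignment `bI` of an index map to every member, `∀ x z, β (sIK (bI x) z) = blkOf z` is FALSE, and
  `memberY_exists_not_sIK_section` names a cornered member where it fails for all `bI` at once; §3 restates both at the record `θ : Stage3Params` in the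
  certificate's binder text (`bI := bIYOfRecord θ M⋆`, band hypotheses discharged by `θ.hb`, only `4 ≤ θ.ℓ₆` displayed).
WHAT DOES HOLD at every member and every site, BY NAME (§1, §3): CARRIER-FAITHFUL on carrier blocks (`sIK_bIOfRecord_faithful` ← `B9CoReadingCoordsS.sIK_faithful`
+ `bIOfRecord_hβI`), 1-FAITHFUL `d_T(β (sIK … z), Δ(z)) ≤ 1` (`sIK_bIOfRecord_dist_le_one` ← `B9CoReadingCoordsL2S.sIK_dist_le_one` + `bIOfRecord_hβ1`),
LEVEL-FAITHFUL `lvl (sIK … z) = j(z)` (`sIK_bIOfRecord_level` ← `B9CoReadingCoordsS.sIK_level` + `bIOfRecord_hlev`).  CONSEQUENCE (recorded, not acted on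
here): a rows-18 bridge at the record must read its (3.42) tables through the 1-FAITHFUL law (the located geometric point of n06-k's `B9CoReadingCoordsL2`
header: «`hβ1` makes radius 2 suffice»), or display the corner-free side condition `Surjective β` per member — the exact `hβs` is not available.

## WHAT THIS FILE CERTIFIES (kernel-checked; theorems only; 0 `def`, 0 `def … : Prop`, 0 sorry; standard axioms)

* §1 at a census index `i`, `bI := bIOfRecord i`: `sIK_bIOfRecord_faithful`, `sIK_bIOfRecord_level`, `sIK_bIOfRecord_dist_le_one`; ★ `surjective_beta_of_sIK_section`
  (any `bI`), `not_sIK_section_of_not_surjective` (any `bI`), `sIK_bIOfRecord_section_of_surjective`, ★ `sIK_bIOfRecord_section_iff`.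
* §2 the family: ★★ `not_forall_memberY_sIK_section` (any `bI`), ★ `memberY_exists_not_sIK_section`.
* §3 at the record `θ`: `sIK_bIYOfRecord_faithful ∕ _level ∕ _dist_le_one ∕ _section_iff`, ★★ `not_forall_memberY_sIK_bIYOfRecord_section (hℓ : 4 ≤ θ.ℓ₆)`,
  `not_forall_memberY_sIK_section_record` (any `bI` at the record's member type).

HONEST SCOPE.  Lattice bookkeeping over the tree's own domain datum and NODE 00's landed corner theorem; nothing of [4] or [B9] asserted; no bridge
re-typed (n06-c's ∕ n06-d's call); helper, COUNT-NEUTRAL; N06 NOT discharged; K1⁹ NOT closed; one finite `𝕋^{d+1}` programme at fixed `ε` — nothing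
continuum, nothing about OS axioms or the mass gap.  Cell `pub-ymgap` (HUMAN RULING D-0062), NODE 00 `pub-ymgap-node00-def-Y` (g30), 2026-08-30;
filed `--supports stmt-QuantumFields-20541`.
-/

namespace Literature.MathematicalPhysics.QuantumFieldTheory.Balaban1983to89.Node00.OpsYSiteIndexOfRecord

open Node00
open B6GlobalChartV1 (blkV1)
open B6Geom246MultiLevelBox (bset blkOf exists_blkOf_eq)
open B6Geom246MultiLevelTorus (geomT)
open B6Ineq2142KLevelV1 (lvl β)
open B6KLevelCensusIndexV1 (KIdx)
open B9PinMembersKLevelV1 (MemberY geo9Y)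
open B9CoReadingCoordsS (sIK sIK_faithful sIK_level)
open B9CoReadingCoordsL2S (sIK_dist_le_one)
open Node00.OpsYBondMapOfRecord (bIOfRecord bIOfRecord_hβI bIOfRecord_hlev bIOfRecord_hβ1 bIYOfRecord)
open Node00.MemberYCornered (memberY_exists_not_surjective_beta)

variable {d ℓ : ℕ} {hd : 1 ≤ d + 1} {hL : Odd (ℓ + 1) ∧ 1 < ℓ + 1} {b₀ b₁ : ℝ}

/-! ## §1 At a census index: the three laws of `sIK (bIOfRecord i)`, and the section law ⟺ `β` onto -/

section Index

variable (i : KIdx d ℓ hd hL b₀ b₁)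

/-- CARRIER-FAITHFUL on carrier blocks: if `Δ(z) = β c` for some index bond `c`, then `β (sIK (bIOfRecord i) z) = Δ(z)`.
[cite: Balaban1984PropagatorsII, (2.45)–(2.46) p.231; Balaban1985BackgroundPropagators, (3.42) p.397] -/
theorem sIK_bIOfRecord_faithful (z : SiteY i) (c : IBondY i) (hz : blkOf i.D.toDomains z = β i.hN i.D i.hk c) :
    β i.hN i.D i.hk (sIK i (bIOfRecord i) z) = blkOf i.D.toDomains z :=
  sIK_faithful i (bIOfRecord_hβI i) z c hz

/-- LEVEL-FAITHFUL: `lvl (sIK (bIOfRecord i) z) = j(z)`. [cite: Balaban1984PropagatorsII, (2.3)–(2.4) p.224, (2.45) p.231] -/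
theorem sIK_bIOfRecord_level (z : SiteY i) : lvl i.hN i.D i.hk (sIK i (bIOfRecord i) z) = (blkOf i.D.toDomains z).1.1 :=
  sIK_level i (bIOfRecord_hlev i) z

/-- 1-FAITHFUL: `d_T(β (sIK (bIOfRecord i) z), Δ(z)) ≤ 1` at EVERY site (orphan blocks included). [cite: Balaban1984PropagatorsII, (2.46) p.231; Balaban1985BackgroundPropagators, (3.42) p.397] -/
theorem sIK_bIOfRecord_dist_le_one (z : SiteY i) :
    (geomT i.D).dist (β i.hN i.D i.hk (sIK i (bIOfRecord i) z)) (blkOf i.D.toDomains z) ≤ 1 :=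
  sIK_dist_le_one i (bIOfRecord_hβ1 i) z

/-- ★ the exact section law of ANY site-index map forces `β` ONTO `𝔅` (every block has a site). [cite: Balaban1984PropagatorsII, (2.45) p.231] -/
theorem surjective_beta_of_sIK_section (bI : FBondY i → IBondY i)
    (hβs : ∀ z : SiteY i, β i.hN i.D i.hk (sIK i bI z) = blkOf i.D.toDomains z) : Function.Surjective (β i.hN i.D i.hk) := by
  intro s
  obtain ⟨z, hz⟩ := exists_blkOf_eq (D := i.D.toDomains) s
  exact ⟨sIK i bI z, (hβs z).trans hz⟩

/-- at a cornered member (`β` not onto `𝔅`) NO site-index map satisfies the exact section law. [cite: Balaban1984PropagatorsII, (2.45) p.231 + p.248] -/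
theorem not_sIK_section_of_not_surjective (hβ : ¬ Function.Surjective (β i.hN i.D i.hk)) (bI : FBondY i → IBondY i) :
    ¬ ∀ z : SiteY i, β i.hN i.D i.hk (sIK i bI z) = blkOf i.D.toDomains z :=
  fun h => hβ (surjective_beta_of_sIK_section i bI h)

/-- at a corner-free member (`β` onto `𝔅`) def-Y's map of record satisfies the exact section law. [cite: Balaban1984PropagatorsII, (2.45)–(2.46) p.231] -/
theorem sIK_bIOfRecord_section_of_surjective (hβ : Function.Surjective (β i.hN i.D i.hk)) (z : SiteY i) :
    β i.hN i.D i.hk (sIK i (bIOfRecord i) z) = blkOf i.D.toDomains z := by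
  obtain ⟨c, hc⟩ := hβ (blkOf i.D.toDomains z)
  exact sIK_bIOfRecord_faithful i z c hc.symm

/-- ★ **THE SECTION LAW OF RECORD ⟺ CORNER-FREE**: `(∀ z, β (sIK (bIOfRecord i) z) = Δ(z)) ↔ β onto 𝔅`. [cite: Balaban1984PropagatorsII, (2.45)–(2.46) p.231 + p.248] -/
theorem sIK_bIOfRecord_section_iff :
    (∀ z : SiteY i, β i.hN i.D i.hk (sIK i (bIOfRecord i) z) = blkOf i.D.toDomains z) ↔ Function.Surjective (β i.hN i.D i.hk) :=
  ⟨surjective_beta_of_sIK_section i (bIOfRecord i), sIK_bIOfRecord_section_of_surjective i⟩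

end Index

/-! ## §2 The family: the exact section law fails at cornered members, for every index map -/

section Family

variable {Mstar : ℕ}

/-- ★ a CORNERED member of print's family (`L ≥ 5` odd, `k ≥ 3`, `M ≥ M₂`) at which the exact section law fails for EVERY site-index map.
[cite: Balaban1985BackgroundPropagators, p.399 l.2–4 (uniformity in {Ω_j}); Balaban1984PropagatorsII, (2.1)–(2.4) p.224, (2.45) p.231] -/
theorem memberY_exists_not_sIK_section (hℓ : 4 ≤ ℓ) {k : ℕ} (hk : 3 ≤ k) (hb₀ : 0 < b₀) (hb₁ : b₀ ≤ b₁) (M₂ : ℝ) :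
    ∃ x : MemberY d ℓ hd hL b₀ b₁ Mstar, x.k = k ∧ M₂ ≤ (geo9Y x).M ∧
      ∀ bI : FBondY x.toKIdx → IBondY x.toKIdx,
        ¬ ∀ z : SiteY x.toKIdx, β x.toKIdx.hN x.toKIdx.D x.toKIdx.hk (sIK x.toKIdx bI z) = blkOf x.toKIdx.D.toDomains z := by
  obtain ⟨x, hk', hM, hβ⟩ := memberY_exists_not_surjective_beta (d := d) (hd := hd) (hL := hL) (Mstar := Mstar) hℓ hk hb₀ hb₁ M₂
  exact ⟨x, hk', hM, fun bI => not_sIK_section_of_not_surjective x.toKIdx hβ bI⟩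

/-- ★★ **NO FAMILY-LEVEL SECTION BINDER**: whenever the member type is served (`L ≥ 5` odd, band `0 < b₀ ≤ b₁`; any `d`, any floor `M⋆`), for EVERY
assignment `bI` of an index map to every member, `∀ x z, β (sIK (bI x) z) = Δ(z)` is FALSE — the binder `hβs` of `B9Local342AtPins` cannot be
discharged uniformly in the member. [cite: Balaban1984PropagatorsII, (2.45) p.231 + p.248; Balaban1985BackgroundPropagators, p.399 l.2–4 (uniformity in {Ω_j})] -/
theorem not_forall_memberY_sIK_section (hℓ : 4 ≤ ℓ) (hb₀ : 0 < b₀) (hb₁ : b₀ ≤ b₁)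
    (bI : (x : MemberY d ℓ hd hL b₀ b₁ Mstar) → FBondY x.toKIdx → IBondY x.toKIdx) :
    ¬ ∀ (x : MemberY d ℓ hd hL b₀ b₁ Mstar) (z : SiteY x.toKIdx),
        β x.toKIdx.hN x.toKIdx.D x.toKIdx.hk (sIK x.toKIdx (bI x) z) = blkOf x.toKIdx.D.toDomains z := by
  intro h
  obtain ⟨x, -, -, hx⟩ := memberY_exists_not_sIK_section (d := d) (hd := hd) (hL := hL) (Mstar := Mstar) hℓ (le_refl 3) hb₀ hb₁ 0
  exact hx (bI x) (h x)

end Family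

/-! ## §3 At the record `θ : Stage3Params`, in the certificate's binder text (`bI := bIYOfRecord θ M⋆`) -/

section Record

variable (θ : Stage3Params) (Mstar : ℕ)

/-- CARRIER-FAITHFUL on carrier blocks, at the record. [cite: Balaban1984PropagatorsII, (2.45)–(2.46) p.231; Balaban1985BackgroundPropagators, (3.42) p.397] -/
theorem sIK_bIYOfRecord_faithful (x : MemberY θ.d₆ θ.ℓ₆ θ.hd' θ.hL' θ.b₀ θ.b₁ Mstar) (z : SiteY x.toKIdx) (c : IBondY x.toKIdx)
    (hz : blkOf x.toKIdx.D.toDomains z = β x.toKIdx.hN x.toKIdx.D x.toKIdx.hk c) :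
    β x.toKIdx.hN x.toKIdx.D x.toKIdx.hk (sIK x.toKIdx (bIYOfRecord θ Mstar x) z) = blkOf x.toKIdx.D.toDomains z :=
  sIK_bIOfRecord_faithful x.toKIdx z c hz

/-- LEVEL-FAITHFUL, at the record. [cite: Balaban1984PropagatorsII, (2.3)–(2.4) p.224, (2.45) p.231] -/
theorem sIK_bIYOfRecord_level (x : MemberY θ.d₆ θ.ℓ₆ θ.hd' θ.hL' θ.b₀ θ.b₁ Mstar) (z : SiteY x.toKIdx) :
    lvl x.toKIdx.hN x.toKIdx.D x.toKIdx.hk (sIK x.toKIdx (bIYOfRecord θ Mstar x) z) = (blkOf x.toKIdx.D.toDomains z).1.1 :=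
  sIK_bIOfRecord_level x.toKIdx z

/-- 1-FAITHFUL at every site, at the record. [cite: Balaban1984PropagatorsII, (2.46) p.231; Balaban1985BackgroundPropagators, (3.42) p.397] -/
theorem sIK_bIYOfRecord_dist_le_one (x : MemberY θ.d₆ θ.ℓ₆ θ.hd' θ.hL' θ.b₀ θ.b₁ Mstar) (z : SiteY x.toKIdx) :
    (geomT x.toKIdx.D).dist (β x.toKIdx.hN x.toKIdx.D x.toKIdx.hk (sIK x.toKIdx (bIYOfRecord θ Mstar x) z)) (blkOf x.toKIdx.D.toDomains z) ≤ 1 :=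
  sIK_bIOfRecord_dist_le_one x.toKIdx z

/-- ★ at the record: n06-c's binder `hβs` at `bI := bIYOfRecord θ M⋆ x` holds IFF the member is corner-free. [cite: Balaban1984PropagatorsII, (2.45)–(2.46) p.231 + p.248] -/
theorem sIK_bIYOfRecord_section_iff (x : MemberY θ.d₆ θ.ℓ₆ θ.hd' θ.hL' θ.b₀ θ.b₁ Mstar) :
    (∀ z : SiteY x.toKIdx, β x.toKIdx.hN x.toKIdx.D x.toKIdx.hk (sIK x.toKIdx (bIYOfRecord θ Mstar x) z) = blkOf x.toKIdx.D.toDomains z) ↔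
      Function.Surjective (β x.toKIdx.hN x.toKIdx.D x.toKIdx.hk) :=
  sIK_bIOfRecord_section_iff x.toKIdx

/-- ★★ **AT THE RECORD, NO FAMILY-LEVEL `hβs`** (`L ≥ 5`; the band hypotheses are `θ.hb`): `∀ x z, β (sIK (bIYOfRecord θ M⋆ x) z) = Δ(z)` is FALSE.
[cite: Balaban1984PropagatorsII, (2.45) p.231 + p.248; Balaban1985BackgroundPropagators, p.399 l.2–4 (uniformity in {Ω_j})] -/
theorem not_forall_memberY_sIK_bIYOfRecord_section (hℓ : 4 ≤ θ.ℓ₆) :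
    ¬ ∀ (x : MemberY θ.d₆ θ.ℓ₆ θ.hd' θ.hL' θ.b₀ θ.b₁ Mstar) (z : SiteY x.toKIdx),
        β x.toKIdx.hN x.toKIdx.D x.toKIdx.hk (sIK x.toKIdx (bIYOfRecord θ Mstar x) z) = blkOf x.toKIdx.D.toDomains z :=
  not_forall_memberY_sIK_section hℓ θ.hb.1 θ.hb.2 (bIYOfRecord θ Mstar)

/-- the same for ANY index-map binder `bI` of the certificate (`L ≥ 5`). [cite: Balaban1984PropagatorsII, (2.45) p.231 + p.248; Balaban1985BackgroundPropagators, p.399] -/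
theorem not_forall_memberY_sIK_section_record (hℓ : 4 ≤ θ.ℓ₆)
    (bI : (x : MemberY θ.d₆ θ.ℓ₆ θ.hd' θ.hL' θ.b₀ θ.b₁ Mstar) → FBondY x.toKIdx → IBondY x.toKIdx) :
    ¬ ∀ (x : MemberY θ.d₆ θ.ℓ₆ θ.hd' θ.hL' θ.b₀ θ.b₁ Mstar) (z : SiteY x.toKIdx),
        β x.toKIdx.hN x.toKIdx.D x.toKIdx.hk (sIK x.toKIdx (bI x) z) = blkOf x.toKIdx.D.toDomains z :=
  not_forall_memberY_sIK_section hℓ θ.hb.1 θ.hb.2 bI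

end Record

end Literature.MathematicalPhysics.QuantumFieldTheory.Balaban1983to89.Node00.OpsYSiteIndexOfRecord
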